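import Summits.BirchSwinnertonDyer.Rank1Residual.X4.AdditiveOldShape
import Summits.BirchSwinnertonDyer.Rank1Residual.Additive.X4TamDefectMazurPrincipleNewVanishing
import Summits.BirchSwinnertonDyer.Rank1Residual.X4.KimDefectLevelLoweringRankOne
import Literature.NumberTheory.EllipticCurves.AdditiveReductionSemistableModelProofs
import HarnessLib

/-!
# TAM-DEFECT₂ at an ADDITIVE defect prime (the NL residue): two typed targets at levels `N`, `N/ℓ`, one sign certificate, and the ENDs (cell `b2b-bsdres`, seat additive-p4, line V48)

HONEST FRAMING (verbatim, cell `b2b-bsdres`): the goal of the cell is to DELETE the COMBINATION-SHAPED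
residual classes for ALL analytic-rank `≤ 1` curves over `ℚ` — "full BSD formula for every rank `≤ 1`
curve in class `C`" assembled STRICTLY from published theorems — so that the rank-`≤ 1` remainder
becomes exactly the CONSTRUCTION-SHAPED classes, which are TYPED (missing-input Props), NOT attempted;
this is not "finishing BSD". This file (CLASS-CLOSURE lane, class N11 TAM-DEFECT₂(3), sub-class NL = the rows
whose Tamagawa defect sits at an ADDITIVE prime `ℓ`: `ℓ² ∥ N`, type IV/IV*, `c_ℓ = 3`, `p = 3`): TWO typed
targets (`@[conjecture] def`, asserting nothing), KERNEL bridge theorems, END theorems. Nothing booked; X4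
stays CONSTRUCTION-SHAPED; no Literature fact.

## The mathematics (why the MP machinery of V45/V46 transfers to an additive prime)

For `W` additive at `ℓ ≠ 3` with `3 ∣ c_ℓ` (Kodaira IV/IV*, `c_ℓ = 3`) one has `W(ℚ_ℓ)[3] ≠ 0`, so
`ρ̄ = W[3]` restricted to `D_ℓ` fixes a line and `ρ̄(I_ℓ)` is unipotent; a finite subgroup of
`GL₂(ℤ₃)` of order prime to `3` injects mod `3`, so the inertia image on `T₃W` is cyclic of order
`3` (tame, also at `ℓ = 2`), acting with eigenvalues `ζ₃^{±1}`; the lattice is `≅ ℤ₃[ζ₃]` and MOD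
3 the inertia acts UNIPOTENTLY and NON-TRIVIALLY: `ρ̄` is ramified at `ℓ` with conductor exponent
`1` (the exponent of `ρ` is `2`). Hence (Diamond 1995 Thm. 1.1 — his `ℓ` = our `p = 3` — with Thms.
5.1/5.2, Lemma 2.1 (3) for the weight-`2` trade; Carayol 1989 for `p ≥ 5`) a weight-`2` newform `g` with `ρ̄_g ≅ ρ̄` lives at a level dividing
`M = N/ℓ` and divisible by `ℓ` (`ℓ ∥ N(ρ̄)`), `ℓ`-new with `U_ℓ g = w g`, `w = ±1`; and
`3 ∣ c_ℓ` ⟺ `W(ℚ_ℓ)[3] ≠ 0` ⟺ the stable line `ηχ̄` of `ρ̄|_{D_ℓ}` is trivial ⟺ `w ≡ ℓ (mod 3)`.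
On the modular-symbol side this reads: (NV) `[·]⁺_f mod 3` kills the `ℓ`-new cycles of `X₀(N)`
(relative to `X₀(M)`, `ℓ ∣ M`) — target `MazurPrincipleNewVanishingAdditive`; (IS) the two-copy
map `(α_*, β_*) : H₁(X₀(N), ℤ) → H₁(X₀(M), ℤ)²` is surjective after localisation at the maximal
ideal `𝔫 = (3, T_r − a_r(W))` — target `IharaSurjectiveAtAdditive` (three-level Ihara, Wiles 1995
Lemma 2.5 / Darmon–Diamond–Taylor Lemma 4.28 (b) + 4.30, COLLAPSES to the two-copy statement because `𝔫` is not
in the support of `H₁(X₀(N/ℓ²), ℤ)`, `ρ̄` being ramified at `ℓ`; cf. Diamond–Ribet 1997, proof of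
Lemma 4.6, case `m_p = 1`); (U) `U_ℓ ≡ w` on the `𝔫`-part of `H₁(X₀(M), ℤ)` with `w ≡ ℓ (mod 3)` —
a finite CERTIFICATE at level `M` (hypothesis `hU`; theory: Carayol's local-global compatibility at
`ℓ ∥ M`, Carayol 1986 Thm. (A), + `3 ∣ c_ℓ`). The kernel chain (`X4/OldPairOfIharaSurj`, `X4/AdditiveOldShape`):
(NV) + (IS) ⟹ `[·]⁺_f = Λ₁∘α_* + Λ₂∘β_*` on cycles ⟹ (Fitting projection) eigen components ⟹ (`a_ℓ(f) = 0`) `Λ₂ = −ℓ⁻¹Λ₁∘U_ℓ^∨`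
⟹ (U) `[r]⁺_f ≡ μ(r) − μ(ℓ r)` = gen 20's `PlusSymbolLevelLowersAt W 3 f ℓ` ⟹ `∂^(∞) ≥ 1` ⟹ (parity + Kim 2025, ANNOUNCED) `BSD₃(W)`.

## What is here

TARGETS `MazurPrincipleNewVanishingAdditive`, `IharaSurjectiveAtAdditive` (the binders `p ∣ c_ℓ`, `ℓ` additive, `p` odd force
`p = 3`, type IV/IV*); KERNEL `plusSymbolLevelLowersAt_of_newVanishing_additive` ((NV)+(IS)+(U)+numerals ⟹ the certificate),
`plusSymbolLevelLowersAt_of_additive_targets`; ENDs `X4.bsdp_of_additive_targets_of_tamagawa_le_two_of_shaAn_unit_of_kim2025_OPEN`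
(rank `0`, modulo Kim 2025), `X4RankOne.bsdp_three_of_additive_targets_of_partial_levelTwo` (rank `1`, modulo `X4SharpThreeKimRankOnePartial`).
EVIDENCE (instrument E5, `gen27/28-evidence/`): (NV) and (NV)+(IS) ("OLD-direct") hold on every NL row computed (gen 28: 161/161 defect pairs, N < 30000).

## References

* H. Carayol, Duke Math. J. 59 (1989) (`p ≥ 5` level optimisation) [cite: Carayol1989, Théorème 1]; Ann. Sci. ÉNS 19 (1986), Thm. (A) (local-global at `ℓ ∥ M`; with Livné / Edixhoven 1997 §1: the prime-to-`p` conductor divides the level). [cite: CarayolASENS1986, Théorème (A), pp. 410–411] [cite: Edixhoven1997, §1 p. 224]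
* A. Wiles, Ann. of Math. 141 (1995), Lemma 2.5, (2.13), pp. 494–495. [cite: Wiles1995Annals, Lemma 2.5 p. 493; (2.13) p. 494; pp. 494–495 (J_H, three-copy form)]
* F. Diamond, in Coates–Yau (1995/1997), Thm. 1.1, 5.1, 5.2, Lemma 2.1 (3). [cite: Diamond1995RefinedSerre, Thm. 1.1, Thm. 5.1, Thm. 5.2, Lemma 2.1 (3)]
* F. Diamond, K. Ribet, in Cornell–Silverman–Stevens (1997), §4.4 Lemma 4.6 [cite: DiamondRibet1997, §4.4 Lemma 4.6]; H. Darmon, F. Diamond, R. Taylor (1995), Lemma 4.28, 4.30, §4.5. [cite: DarmonDiamondTaylor1995, Lemma 4.28 (a)–(b), Lemma 4.30 (a)–(b), §4.5 pp. 135–137]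
* C.-H. Kim, Amer. J. Math. 148 (2026); J. H. Silverman, *AEC* (2009), §C.16. [cite: Kim2022StructureSelmer, Thm. 1.9 (6) and Conj. 1.10 (PDF p. 8)] [cite: SilvermanAEC2009, §C.16 (definition of L_v(T)), PDF p. 390]
-/

noncomputable section

open scoped MatrixGroups ModularForm Classical

open CongruenceSubgroup Finset

open Literature.NumberTheory.EllipticCurves Literature.NumberTheory.EllipticCurves.ModularForms

namespace Summit.BirchSwinnertonDyer.Rank1Residual.LevelLowering

/-! ### §1 The typed targets at an additive defect prime -/

section Target

variable (W : WeierstrassCurve ℚ) [W.IsGloballyMinimal] (p : ℕ) [Fact p.Prime]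
  {M : ℕ} [NeZero M] (ℓ : ℕ) [Fact ℓ.Prime] (f : CuspForm (Gamma0 (M * ℓ)) 2)

/-- **LEVEL LOWERING AT AN ADDITIVE DEFECT PRIME AS A VANISHING STATEMENT (typed target; V48).**
For `W/ℚ` globally minimal with newform `f` at its conductor `N = Mℓ`, an odd prime `p` with `W[p]`
irreducible, and a prime `ℓ ≠ p`, `ℓ ∣ M` (so `ℓ² ∣ N`), of ADDITIVE reduction (`ℓ ∣ Δ_min`,
`ℓ ∣ c₄`) with `p ∣ c_ℓ(W)` — which forces `p = 3`, Kodaira type IV or IV*, and a TAME inertia image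
`C₃` at `ℓ` (also at `ℓ = 2`: `W(ℚ_ℓ)[3] ≠ 0` makes `ρ̄(I_ℓ)` unipotent, so no wild part survives) — the
mod-`p` plus symbol of `f` VANISHES ON THE `ℓ`-NEW CYCLES of `X₀(Mℓ)` relative to `X₀(M)`: for every
`γ ∈ Γ₀(Mℓ)` with finite cusp whose cycle `{∞, γ∞}` is killed by both push-forwards
`α_* = (degeneracyMap0 M (Mℓ) 1 2)^∨`, `β_* = (degeneracyMap0 M (Mℓ) ℓ 2)^∨`, `[γ∞]⁺_f ≡ 0 (mod p)`.
STATUS: NOT in print as stated. Provenance: `ρ̄ = W[3]` has conductor exponent `1` at `ℓ` (inertia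
of order `3` acts unipotently mod `3`), so `ℓ ∥ N(ρ̄)` and a weight-`2` newform `g` of level
DIVIDING `M` with `ρ̄_g ≅ ρ̄` exists — at `p = 3` by Diamond 1995 Thm. 1.1 (Diamond's `ℓ` = our `p`:
`ρ̄` arises from `S_{k(ρ̄)}(Γ₁(N(ρ̄)))`) and the weight-`2` trade at a level dividing `M` (`N(ρ̄)`,
`3N(ρ̄)`, or via Thm. 5.2 since `9 ∣ N`; Thm. 5.1; Carayol's lemma 2.1 (3) in the case "`ρ̄` not
induced from `G_{ℚ(√−3)}`" — a hypothesis NOT among the binders below: irreducibility does not give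
it, surjectivity does; immaterial to the per-row decisions); Carayol 1989 is the `p ≥ 5` form. The
identification of `f`'s mod-`p` symbol with an `ℓ`-old one needs a multiplicity-one input for the
`𝔫`-part of `J₀(N)`, NOT in print on the corner (`p² ∣ N`). The name follows Mazur's principle
(Ribet–Stein 3.14 / 3.17) as a TEMPLATE only (its `p ∤ M`, `ρ̄` unramified at `p` fail here). Decided
per row at level `N` by the seat's instrument E5 (EVIDENCE). A TARGET; nothing asserted. [cite: Carayol1989, Théorème 1]
[cite: Diamond1995RefinedSerre, Thm. 1.1, Thm. 5.1, Thm. 5.2, Lemma 2.1 (3)]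
[cite: RibetStein2001, Thm. 3.14 and Lemma 3.17 (name/template only)] -/
@[conjecture] def MazurPrincipleNewVanishingAdditive : Prop :=
  IsNewformOf W f → W.conductorNorm ℤ = M * ℓ → p ≠ 2 → W.HasIrreducibleModPGaloisRep p →
    ℓ ≠ p → ℓ ∣ M → (ℓ : ℤ) ∣ W.minimalDiscriminantInt →
    (ℓ : ℤ) ∣ (WeierstrassCurve.integralModelInt W).c₄ →
    p ∣ (W.baseChange ℚ_[ℓ]).localTamagawaNumber ℤ_[ℓ] →
    ∀ γ : Gamma0 (M * ℓ), (γ : SL(2, ℤ)) 1 0 ≠ 0 →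
      (degeneracyMap0 M (M * ℓ) 1 2).dualMap (periodFunctional (M * ℓ) γ) = 0 →
      (degeneracyMap0 M (M * ℓ) ℓ 2).dualMap (periodFunctional (M * ℓ) γ) = 0 →
        ((ratPlusSymbol f ((((γ : SL(2, ℤ)) 0 0 : ℤ) : ℚ) / (((γ : SL(2, ℤ)) 1 0 : ℤ) : ℚ)) : ℚ) :
            ZMod p) = 0

/-- **TWO-COPY IHARA SURJECTIVITY AT THE MAXIMAL IDEAL OF THE ROW, `ℓ ∣ M` (typed target; V48).**
Same row data as `MazurPrincipleNewVanishingAdditive`. Let `𝕋̃ = ℤ[T_r : r ∤ Mℓ]` (level-`M`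
operators, `HeckeRing0.primeTo M 2 (Mℓ)`) and let `𝔫 ⊂ 𝕋̃` be a maximal ideal containing `p` and
every `T_r − a_r(W)` (`r ∤ Mℓ`), not Eisenstein. Then some `s ∈ 𝕋̃ ∖ 𝔫` multiplies
`H₁(X₀(M), ℤ) × H₁(X₀(M), ℤ)` into the image of `(α_*, β_*) : H₁(X₀(Mℓ), ℤ) → H₁(X₀(M), ℤ)²` — the
localisation at `𝔫` of the two-copy map is surjective, EXACTLY the shape of Ihara's lemma
`ribet1984_iharaLemma` (which needs `ℓ ∤ M`). STATUS: NOT in print as stated. Provenance: with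
`M = M′ℓ`, `ℓ ∤ M′`, the image lies in `K = ker(β′_* pr₁ − α′_* pr₂)` and `K/im` has no `𝔫`-part
by the THREE-LEVEL Ihara lemma (Wiles 1995 Lemma 2.5, printed for `X₁(M′, ℓ^k)` localised at
`𝔪^{(q)}` with `ρ_𝔪` irreducible; its (2.13) = DDT Lemma 4.28 (b) un-localised; DDT p. 137 with 4.30;
for `Γ_H ⊇ Γ₀` Wiles pp. 494–495 / DDT p. 137 print the THREE-COPY form, the `Γ₀` middle-exactness is
Diamond–Ribet §4.4; the binders `N > 3` / `N_Σ > 3p` disappear after localisation, Wiles p. 494);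
`H₁(X₀(M), ℤ)²/K ↪ H₁(X₀(M′), ℤ)` has no `𝔫`-part because `ρ̄` is RAMIFIED at `ℓ ∤ M′p` (Carayol
1986 Thm. (A) / Livné: the prime-to-`p` conductor of `ρ̄_g` divides the level) — and `ρ̄ = W[3]` IS
ramified at a type IV/IV* prime `ℓ ≠ 3` with `3 ∣ c_ℓ` (unipotent inertia of order `3`). Cf.
Diamond–Ribet 1997, proof of Lemma 4.6, case `m_p = 1`, `p ≠ ℓ`. A TARGET; nothing asserted.
[cite: Wiles1995Annals, Lemma 2.5 p. 493; (2.13) p. 494; pp. 494–495 (J_H, three-copy form)]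
[cite: DarmonDiamondTaylor1995, Lemma 4.28 (a)–(b), Lemma 4.30 (a)–(b), §4.5 pp. 135–137]
[cite: DiamondRibet1997, §4.4 Lemma 4.6] [cite: CarayolASENS1986, Théorème (A), pp. 410–411]
[cite: Edixhoven1997, §1 p. 224] -/
@[conjecture] def IharaSurjectiveAtAdditive : Prop :=
  IsNewformOf W f → W.conductorNorm ℤ = M * ℓ → p ≠ 2 → W.HasIrreducibleModPGaloisRep p →
    ℓ ≠ p → ℓ ∣ M → (ℓ : ℤ) ∣ W.minimalDiscriminantInt →
    (ℓ : ℤ) ∣ (WeierstrassCurve.integralModelInt W).c₄ →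
    p ∣ (W.baseChange ℚ_[ℓ]).localTamagawaNumber ℤ_[ℓ] →
    ∀ 𝔫 : Ideal (HeckeRing0.primeTo M 2 (M * ℓ)), 𝔫.IsMaximal →
      (p : HeckeRing0.primeTo M 2 (M * ℓ)) ∈ 𝔫 →
      (∀ (r : ℕ) (hr : r.Prime) (hrS : ¬ r ∣ M * ℓ),
        HeckeRing0.primeTo.T M 2 (M * ℓ) hr hrS -
          ((W.LFunction r : ℤ) : HeckeRing0.primeTo M 2 (M * ℓ)) ∈ 𝔫) →
      ¬ HeckeRing0.primeTo.IsEisenstein 𝔫 →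
      ∃ s : HeckeRing0.primeTo M 2 (M * ℓ), s ∉ 𝔫 ∧
        ∀ x ∈ periodHomology M, ∀ y ∈ periodHomology M, ∃ z ∈ periodHomology (M * ℓ),
          (degeneracyMap0 M (M * ℓ) 1 2).dualMap z = (s : HeckeRing0 M 2) • x ∧
          (degeneracyMap0 M (M * ℓ) ℓ 2).dualMap z = (s : HeckeRing0 M 2) • y

end Target

/-! ### §1b The `U_ℓ`-sign certificate (a finite statement at level `M`; a hypothesis, not a target) -/

section Sign

variable (W : WeierstrassCurve ℚ) (p M ℓ : ℕ) [NeZero M] [Fact ℓ.Prime] (w : ℤ)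

/-- **THE `U_ℓ`-SIGN CERTIFICATE at level `M`**: for every maximal `𝔫 ⊂ 𝕋̃ = ℤ[T_r : r ∤ Mℓ]`
containing `p` and all `T_r − a_r(W)`, not Eisenstein, some `s₂ ∈ 𝕋̃ ∖ 𝔫` satisfies
`s₂ · (U_ℓ − w) = 0` on `H₁(X₀(M), ℤ)` — "`U_ℓ ≡ w` on the `𝔫`-part". A FINITE linear-algebra statement
at level `M` (decidable per row, like gen 20's certificate); THEORY (not asserted): every
`𝔫`-eigenform of level `M` is `ℓ`-new with `a_ℓ = η(Frob_ℓ) = w` (Carayol's local-global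
compatibility at `ℓ ∥ M`, Carayol 1986 (A); `ρ̄` ramified at `ℓ` pins `η`), and `3 ∣ c_ℓ` gives
`w ≡ ℓ (mod 3)`. A predicate; nothing asserted. [cite: CarayolASENS1986, Théorème (A), pp. 410–411] -/
def ULSignCertificate : Prop :=
  ∀ 𝔫 : Ideal (HeckeRing0.primeTo M 2 (M * ℓ)), 𝔫.IsMaximal →
    (p : HeckeRing0.primeTo M 2 (M * ℓ)) ∈ 𝔫 →
    (∀ (r : ℕ) (hr : r.Prime) (hrS : ¬ r ∣ M * ℓ),
      HeckeRing0.primeTo.T M 2 (M * ℓ) hr hrS -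
        ((W.LFunction r : ℤ) : HeckeRing0.primeTo M 2 (M * ℓ)) ∈ 𝔫) →
    ¬ HeckeRing0.primeTo.IsEisenstein 𝔫 →
    ∃ s₂ : HeckeRing0.primeTo M 2 (M * ℓ), s₂ ∉ 𝔫 ∧
      ∀ x ∈ periodHomology M,
        (s₂ : HeckeRing0 M 2) • (HeckeRing0.T M 2 ℓ (Fact.out : ℓ.Prime) • x) =
          (s₂ : HeckeRing0 M 2) • ((w : HeckeRing0 M 2) • x)

end Sign

/-! ### §2 The kernel bridge: (NV) + (IS) + the `U_ℓ`-sign certificate ⟹ gen 20's certificate -/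

section Bridge

variable {W : WeierstrassCurve ℚ} [W.IsElliptic] [W.IsGloballyMinimal] {p : ℕ} [hp : Fact p.Prime]
  {M : ℕ} [NeZero M] {ℓ : ℕ} [hℓ : Fact ℓ.Prime] {f : CuspForm (Gamma0 (M * ℓ)) 2}

/-- **THE LEVEL-LOWERING CERTIFICATE AT AN ADDITIVE DEFECT PRIME** — from the vanishing on the
`ℓ`-new cycles (NV), the two-copy Ihara surjectivity at the maximal ideals of `a_•(W) mod p` (IS),
the `U_ℓ`-sign certificate (U) "`s₂(U_ℓ − w) = 0` on `H₁(X₀(M), ℤ)` for some `s₂ ∉ 𝔫`, `w ≡ ℓ`",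
and numerals: `W/ℚ` globally minimal with newform `f` at conductor `Mℓ`, `p` odd with `W[p]`
irreducible (so every `[r]⁺_f` is `p`-integral), `ℓ ≠ p`, `ℓ ∣ M`, `ℓ` additive (`ℓ ∣ Δ_min`,
`ℓ ∣ c₄`, so `a_ℓ(W) = 0`), one prime `q₀ ≡ 1 (mod Mℓ)` with `a_{q₀}(W) ≢ q₀ + 1 (mod p)` ⟹
`PlusSymbolLevelLowersAt W p f ℓ`. Chain: `exists_plusFunctional` (the mod-`p` plus functional `Ψ`),
`exists_oldPair_of_apply_eq_zero_of_surjAt` ((NV)+(IS) ⟹ (OLD) on cycles),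
`exists_sub_mul_of_oldOnCycles_additive_of_surjAt` ((OLD)+(IS)+(U) ⟹ `[r]⁺_f ≡ μ(r) − (ℓ⁻¹w)μ(ℓr)`),
`w ≡ ℓ`. [cite: DiamondRibet1997, §4.4 Lemma 4.6] [cite: Manin1972, Thm. 3.3 (20) and Thm. 3.5 (22)]
[cite: Kim2022StructureSelmer, §1.2.2 and §1.4.3 (PDF pp. 5, 7)] -/
theorem plusSymbolLevelLowersAt_of_newVanishing_additive (hf : IsNewformOf W f)
    (hN : W.conductorNorm ℤ = M * ℓ) (hp2 : p ≠ 2) (hirr : W.HasIrreducibleModPGaloisRep p)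
    (hℓp : ℓ ≠ p) (hℓM : ℓ ∣ M) (hΔ : (ℓ : ℤ) ∣ W.minimalDiscriminantInt)
    (hc₄ : (ℓ : ℤ) ∣ (WeierstrassCurve.integralModelInt W).c₄)
    {q₀ : ℕ} (hq₀ : q₀.Prime) (hq₀1 : q₀ ≡ 1 [MOD M * ℓ])
    (haq₀ : ((W.LFunction q₀ : ℤ) : ZMod p) ≠ q₀ + 1)
    (hNV : ∀ γ : Gamma0 (M * ℓ), (γ : SL(2, ℤ)) 1 0 ≠ 0 →
      (degeneracyMap0 M (M * ℓ) 1 2).dualMap (periodFunctional (M * ℓ) γ) = 0 →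
      (degeneracyMap0 M (M * ℓ) ℓ 2).dualMap (periodFunctional (M * ℓ) γ) = 0 →
        ((ratPlusSymbol f ((((γ : SL(2, ℤ)) 0 0 : ℤ) : ℚ) / (((γ : SL(2, ℤ)) 1 0 : ℤ) : ℚ)) : ℚ) :
            ZMod p) = 0)
    (hS : ∀ 𝔫 : Ideal (HeckeRing0.primeTo M 2 (M * ℓ)), 𝔫.IsMaximal →
      (p : HeckeRing0.primeTo M 2 (M * ℓ)) ∈ 𝔫 →
      (∀ (r : ℕ) (hr : r.Prime) (hrS : ¬ r ∣ M * ℓ),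
        HeckeRing0.primeTo.T M 2 (M * ℓ) hr hrS -
          ((W.LFunction r : ℤ) : HeckeRing0.primeTo M 2 (M * ℓ)) ∈ 𝔫) →
      ¬ HeckeRing0.primeTo.IsEisenstein 𝔫 →
      ∃ s : HeckeRing0.primeTo M 2 (M * ℓ), s ∉ 𝔫 ∧
        ∀ x ∈ periodHomology M, ∀ y ∈ periodHomology M, ∃ z ∈ periodHomology (M * ℓ),
          (degeneracyMap0 M (M * ℓ) 1 2).dualMap z = (s : HeckeRing0 M 2) • x ∧
          (degeneracyMap0 M (M * ℓ) ℓ 2).dualMap z = (s : HeckeRing0 M 2) • y)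
    {w : ℤ} (hw : (w : ZMod p) = ℓ)
    (hU : ULSignCertificate W p M ℓ w) :
    PlusSymbolLevelLowersAt W p f ℓ := by
  classical
  -- newform data: rational coefficients `θ(q) = a_q(W)`, `p`-integral plus symbols
  have hf0 : IsNewform0 f := hf.1
  have hQ : coeffField f = ⊥ := IsNewformOf.coeffField_eq_bot hf
  have hθ : ∀ q : ℕ, q.Prime → (((fun n : ℕ ↦ (W.LFunction n : ℤ)) q : ℤ) : ℂ) = cuspCoeff f q :=
    fun q _ ↦ (hf.2 q).symm
  have hint : ∀ r : ℚ, ¬ p ∣ (ratPlusSymbol f r).den := fun r ↦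
    not_dvd_den_of_norm_ratCast_le_one (Additive.norm_ratPlusSymbol_le_one_of_irreducible hp2 hf hirr r)
  -- the symbol functionals at the two levels
  have hσ := inftyFunctional_cuspMatrix_apply (M * ℓ)
  have hσ' := inftyFunctional_cuspMatrix_apply M
  -- the mod-`p` plus functional `Ψ` of `f`
  obtain ⟨P, Ψ, hσP, hHP, hTP, hΨadd, hΨσ, hΨT⟩ :=
    exists_plusFunctional (p := p) f hf0 hQ hint (fun n : ℕ ↦ (W.LFunction n : ℤ)) hθ
      (fun r ↦ (inftyFunctional (cuspMatrix r) : Module.Dual ℂ (CuspForm (Gamma0 (M * ℓ)) 2))) hσ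
  have hΨ0 : Ψ 0 = 0 := by
    have h := hΨadd 0 P.zero_mem 0 P.zero_mem
    rw [add_zero] at h
    linear_combination -h
  have hΨaddH : ∀ x ∈ periodHomology (M * ℓ), ∀ y ∈ periodHomology (M * ℓ), Ψ (x + y) = Ψ x + Ψ y :=
    fun x hx y hy ↦ hΨadd x (hHP hx) y (hHP hy)
  have hΨT' : ∀ (r : ℕ) (hr : r.Prime), ¬ r ∣ M * ℓ → ∀ z ∈ periodHomology (M * ℓ),
      Ψ (HeckeRing0.T (M * ℓ) 2 r hr • z) = (((W.LFunction r : ℤ) : ℤ) : ZMod p) * Ψ z :=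
    fun r hr _ z hz ↦ hΨT r hr z (hHP hz)
  -- the period functional of `γ` with finite cusp is the symbol functional at `γ∞`
  have e : ∀ γ : Gamma0 (M * ℓ), (γ : SL(2, ℤ)) 1 0 ≠ 0 → periodFunctional (M * ℓ) γ =
      (inftyFunctional (cuspMatrix ((((γ : SL(2, ℤ)) 0 0 : ℤ) : ℚ) / (((γ : SL(2, ℤ)) 1 0 : ℤ) : ℚ))) :
        Module.Dual ℂ (CuspForm (Gamma0 (M * ℓ)) 2)) := by
    intro γ hc
    ext h
    rw [periodFunctional_apply, cuspSymbol, if_neg hc, hσ]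
  -- (NV) for `Ψ` on `H₁(X₀(Mℓ), ℤ)`
  have hvan : ∀ z ∈ periodHomology (M * ℓ), (degeneracyMap0 M (M * ℓ) 1 2).dualMap z = 0 →
      (degeneracyMap0 M (M * ℓ) ℓ 2).dualMap z = 0 → Ψ z = 0 := by
    intro z hz hα hβ
    have hz' : z ∈ (periodHomology (M * ℓ) : Set (Module.Dual ℂ (CuspForm (Gamma0 (M * ℓ)) 2))) := hz
    rw [coe_periodHomology_eq_range] at hz'
    obtain ⟨γ, rfl⟩ := hz'
    by_cases hc : (γ : SL(2, ℤ)) 1 0 = 0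
    · rw [periodFunctional_eq_zero_of_apply_eq_zero γ hc, hΨ0]
    · rw [e γ hc, hΨσ]
      exact hNV γ hc hα hβ
  -- (NV) + (IS) ⟹ (OLD) on cycles
  obtain ⟨Λ₁, Λ₂, hadd₁, hadd₂, hold⟩ :=
    exists_oldPair_of_apply_eq_zero_of_surjAt (fun n : ℕ ↦ (W.LFunction n : ℤ)) Ψ hΨaddH hΨT' hvan
      hq₀ hq₀1 haq₀ hS
  -- `a_ℓ(W) = 0` at the additive prime; `ℓ` is a unit mod `p`
  have haℓ : (W.LFunction ℓ : ℤ) = 0 := W.lFunction_eq_zero_of_dvd_of_dvd ℓ hΔ hc₄ (dvd_refl ℓ)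
  have hθℓ : (((fun n : ℕ ↦ (W.LFunction n : ℤ)) ℓ : ℤ) : ZMod p) = 0 := by
    simp only [haℓ, Int.cast_zero]
  have hℓp' : (ℓ : ZMod p) ≠ 0 := by
    rw [Ne, ZMod.natCast_eq_zero_iff]
    exact fun h ↦ hℓp ((Nat.prime_dvd_prime_iff_eq hp.out hℓ.out).mp h).symm
  -- (OLD) + (IS) + (U) ⟹ the certificate shape on paths
  obtain ⟨μ, hper, hH, hid⟩ := exists_sub_mul_of_oldOnCycles_additive_of_surjAt hℓM
    (fun n : ℕ ↦ (W.LFunction n : ℤ)) hθℓ hℓp'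
    (fun r ↦ (inftyFunctional (cuspMatrix r) : Module.Dual ℂ (CuspForm (Gamma0 (M * ℓ)) 2))) hσ
    (fun r ↦ (inftyFunctional (cuspMatrix r) : Module.Dual ℂ (CuspForm (Gamma0 M) 2))) hσ'
    P Ψ (fun r ↦ ((ratPlusSymbol f r : ℚ) : ZMod p)) hσP hHP hTP hΨadd hΨσ hΨT Λ₁ Λ₂ hadd₁ hadd₂ hold
    hq₀ hq₀1 haq₀ hS w hU
  refine ⟨μ, hper, fun q hq ↦ ?_, fun r ↦ ?_⟩
  · -- Kolyvagin primes are good: `a_q(W) = a_q(f)`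
    haveI : Fact q.Prime := ⟨hq.prime⟩
    have hqN : ¬ q ∣ W.conductorNorm ℤ := hq.not_dvd_conductorNorm
    have hgood : W.HasGoodReductionAtPrime q := hasGoodReductionAtPrime_of_not_dvd_conductorNorm W hqN
    have h := hH q hq.prime (by rwa [hN] at hqN)
    rwa [W.LFunction_apply_prime_eq_frobeniusTrace q hgood] at h
  · rw [hid r, hw, inv_mul_cancel₀ hℓp', one_mul]

omit [W.IsElliptic] in
/-- **The certificate from the two TARGETS and the sign certificate** (target-keyed form of
`plusSymbolLevelLowersAt_of_newVanishing_additive`). [cite: DiamondRibet1997, §4.4 Lemma 4.6]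
[cite: CarayolASENS1986, Théorème (A), pp. 410–411] -/
theorem plusSymbolLevelLowersAt_of_additive_targets [W.IsElliptic]
    (hNV : MazurPrincipleNewVanishingAdditive W p ℓ f) (hIS : IharaSurjectiveAtAdditive W p ℓ f)
    (hf : IsNewformOf W f) (hN : W.conductorNorm ℤ = M * ℓ) (hp2 : p ≠ 2)
    (hirr : W.HasIrreducibleModPGaloisRep p) (hℓp : ℓ ≠ p) (hℓM : ℓ ∣ M)
    (hΔ : (ℓ : ℤ) ∣ W.minimalDiscriminantInt) (hc₄ : (ℓ : ℤ) ∣ (WeierstrassCurve.integralModelInt W).c₄)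
    (hcℓ : p ∣ (W.baseChange ℚ_[ℓ]).localTamagawaNumber ℤ_[ℓ])
    {q₀ : ℕ} (hq₀ : q₀.Prime) (hq₀1 : q₀ ≡ 1 [MOD M * ℓ])
    (haq₀ : ((W.LFunction q₀ : ℤ) : ZMod p) ≠ q₀ + 1)
    {w : ℤ} (hw : (w : ZMod p) = ℓ)
    (hU : ULSignCertificate W p M ℓ w) :
    PlusSymbolLevelLowersAt W p f ℓ :=
  plusSymbolLevelLowersAt_of_newVanishing_additive hf hN hp2 hirr hℓp hℓM hΔ hc₄ hq₀ hq₀1 haq₀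
    (hNV hf hN hp2 hirr hℓp hℓM hΔ hc₄ hcℓ) (hIS hf hN hp2 hirr hℓp hℓM hΔ hc₄ hcℓ) hw hU

end Bridge

end Summit.BirchSwinnertonDyer.Rank1Residual.LevelLowering

/-! ### §3 ENDs: the NL rows of TAM-DEFECT₂(3) close modulo the two targets, the sign certificate, and Kim 2025 -/

namespace Summit.BirchSwinnertonDyer.Rank1Residual.X4

open Complex WeierstrassCurve Literature.NumberTheory.EllipticCurves.Rank1Residual
  Literature.NumberTheory.EllipticCurves.Rank1Residual.Typed
  Summit.BirchSwinnertonDyer.Rank1Residual.LevelLowering Summit.BirchSwinnertonDyer.Rank1Residual.Additive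

variable (W : WeierstrassCurve ℚ) [W.IsElliptic] [W.IsGloballyMinimal] (p : ℕ) [Fact p.Prime]

/-- **TAM-DEFECT₂ CLOSURE AT AN ADDITIVE DEFECT PRIME, rank `0`, CONDITIONAL on the announced Kim
2025 clause** (`hK25s`, flag `Kim2025-preprint`; class N11, sub-class NL). `W/ℚ` globally minimal
of analytic rank `0`, `p ≥ 3`, `ρ̄_{E,p^n}` onto for all `n`, a conductor-level datum `D` at level
`Mℓ = N` with the period transfer, `#Ш_an` a `p`-unit, `ord_p ∏c ≤ 2`; an additive `ℓ ∣ M`,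
`ℓ ≠ p`, `ℓ ∣ Δ_min`, `ℓ ∣ c₄`, with `p ∣ c_ℓ` (so `p = 3`, type IV/IV*); the numeral `q₀`; the
`U_ℓ`-sign certificate (`w ≡ ℓ`); IF the typed targets `MazurPrincipleNewVanishingAdditive` and
`IharaSurjectiveAtAdditive` hold at `(W, p, ℓ, D.f)` THEN **`BSD(E,p)`** — via gen 20's certificate
and `X4.bsdp_of_plusSymbolLevelLowersAt_of_tamagawa_le_two_of_shaAn_unit_of_kim2025_OPEN`
(Cassels–Tate, GZK, modularity BY NAME). Nothing booked. [claim: Kim2025RefinedTNC, status: under-review]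
[cite: Kim2025RefinedTNC, Thm. 1.1 ("BSD") (ANNOUNCED, OPEN binder)]
[cite: Kim2022StructureSelmer, Conj. 1.10 (PDF p. 8)] [cite: DiamondRibet1997, §4.4 Lemma 4.6] -/
theorem bsdp_of_additive_targets_of_tamagawa_le_two_of_shaAn_unit_of_kim2025_OPEN
    (hK25s : Kim2025.thm11_kimShaLength_of_integralPeriod_OPEN)
    (hCT : exists_casselsTate_pairing (K := ℚ))
    (hGZK : rank_eq_analyticRank_of_analyticRank_le_one) (hmod : hasEntireLFunction_rat)
    (hp3 : 3 ≤ p) (hr : W.analyticRank = 0) (htower : ∀ n : ℕ, W.HasSurjectiveModNGaloisRep (p ^ n : ℕ))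
    {M : ℕ} [NeZero M] {ℓ : ℕ} [Fact ℓ.Prime] [NeZero (M * ℓ)]
    (D : ModularParametrizationData W (M * ℓ)) (hN : W.conductorNorm ℤ = M * ℓ)
    (hper : ∃ u : ℚ, ‖(u : ℚ_[p])‖ = 1 ∧ W.realPeriodRat = u * plusPeriod D.f)
    {q' : ℚ} (hq' : shaAn W = (q' : ℂ)) (hv : padicValRat p q' = 0)
    (hc2 : padicValNat p W.tamagawaProduct ≤ 2)
    (hℓp : ℓ ≠ p) (hℓM : ℓ ∣ M) (hΔ : (ℓ : ℤ) ∣ W.minimalDiscriminantInt)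
    (hc₄ : (ℓ : ℤ) ∣ (WeierstrassCurve.integralModelInt W).c₄)
    (hcℓ : p ∣ (W.baseChange ℚ_[ℓ]).localTamagawaNumber ℤ_[ℓ])
    {q₀ : ℕ} (hq₀ : q₀.Prime) (hq₀1 : q₀ ≡ 1 [MOD M * ℓ])
    (haq₀ : ((W.LFunction q₀ : ℤ) : ZMod p) ≠ q₀ + 1)
    {w : ℤ} (hw : (w : ZMod p) = ℓ)
    (hU : ULSignCertificate W p M ℓ w)
    (hNV : MazurPrincipleNewVanishingAdditive W p ℓ D.f) (hIS : IharaSurjectiveAtAdditive W p ℓ D.f) :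
    BSDp W p := by
  have hsurj : W.HasSurjectiveModNGaloisRep p := by simpa using htower 1
  have hirr := hasIrreducibleModPGaloisRep_of_hasSurjectiveModNGaloisRep W p hsurj
  have hp2 : p ≠ 2 := by omega
  have hcert : PlusSymbolLevelLowersAt W p D.f ℓ :=
    plusSymbolLevelLowersAt_of_additive_targets hNV hIS D.isNewformOf hN hp2 hirr hℓp hℓM hΔ hc₄
      hcℓ hq₀ hq₀1 haq₀ hw hU
  have hℓN : ℓ ∣ W.conductorNorm ℤ := by rw [hN]; exact dvd_mul_left ℓ M
  exact bsdp_of_plusSymbolLevelLowersAt_of_tamagawa_le_two_of_shaAn_unit_of_kim2025_OPEN W p hK25s hCT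
    hGZK hmod hp3 hr htower D hN hper hq' hv hcert hℓN hc2

/-- **RANK-ONE NL ROWS at `p = 3`, level TWO, Cassels–Tate-free, MODULO the rank-one conjecture
`X4SharpThreeKimRankOnePartial`** and the two additive targets: `ClassX4 W 3`, `ρ̄_{E,3^n}` onto,
analytic rank `1`, a conductor-level datum at `N = Mℓ₀` with `3 ∤ c_D` and the period transfer, an
additive `ℓ₀ ≠ 3`, `ℓ₀ ∣ M`, `ℓ₀ ∣ Δ_min`, `ℓ₀ ∣ c₄`, `3 ∣ c_{ℓ₀}`, the numeral `q₀`, the `U_{ℓ₀}`-sign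
certificate, ONE Kurihara number `δ̃_ℓ ≢ 0 (mod 9)` at a cyclic level-`2` Kolyvagin prime `ℓ`,
`#Ш_an` a `3`-unit ⟹ `BSD(E,3)`. Per pair; nothing booked.
[cite: Kim2025RefinedTNC, Thm. 1.1 (Str) (PDF p. 4; ANNOUNCED preprint — the reason, not a source of truth)]
[cite: Kim2022StructureSelmer, Thm. 1.8 (3); Thm. 1.9 (3)–(5) (PDF pp. 7–8)] -/
theorem _root_.Summit.BirchSwinnertonDyer.Rank1Residual.X4RankOne.bsdp_three_of_additive_targets_of_partial_levelTwo
    (h3 : X4SharpThreeKimRankOnePartial)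
    (hGZK : rank_eq_analyticRank_of_analyticRank_le_one) (hmod : hasEntireLFunction_rat)
    (hX : ClassX4 W 3) (htower : ∀ n : ℕ, W.HasSurjectiveModNGaloisRep (3 ^ n : ℕ))
    (hr : W.analyticRank = 1)
    {M : ℕ} [NeZero M] {ℓ₀ : ℕ} [Fact ℓ₀.Prime] [NeZero (M * ℓ₀)]
    (D : ModularParametrizationData W (M * ℓ₀)) (hN : W.conductorNorm ℤ = M * ℓ₀)
    (hc : ¬ (3 : ℤ) ∣ D.maninConstant)
    (hper : ∃ u : ℚ, ‖(u : ℚ_[3])‖ = 1 ∧ W.realPeriodRat = u * plusPeriod D.f)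
    (hℓ₀p : ℓ₀ ≠ 3) (hℓ₀M : ℓ₀ ∣ M) (hΔ : (ℓ₀ : ℤ) ∣ W.minimalDiscriminantInt)
    (hc₄ : (ℓ₀ : ℤ) ∣ (WeierstrassCurve.integralModelInt W).c₄)
    (hcℓ₀ : 3 ∣ (W.baseChange ℚ_[ℓ₀]).localTamagawaNumber ℤ_[ℓ₀])
    {q₀ : ℕ} (hq₀ : q₀.Prime) (hq₀1 : q₀ ≡ 1 [MOD M * ℓ₀])
    (haq₀ : ((W.LFunction q₀ : ℤ) : ZMod 3) ≠ q₀ + 1)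
    {w : ℤ} (hw : (w : ZMod 3) = ℓ₀)
    (hU : ULSignCertificate W 3 M ℓ₀ w)
    (hNV : MazurPrincipleNewVanishingAdditive W 3 ℓ₀ D.f) (hIS : IharaSurjectiveAtAdditive W 3 ℓ₀ D.f)
    (ℓ : ℕ) [Fact ℓ.Prime] (hℓ : Kato.IsKolyvaginPrime W 3 2 ℓ)
    (hcyc : Nat.card {P : ((WeierstrassCurve.integralModelInt W).map
        (Int.castRingHom (ZMod ℓ))).toAffine.Point // 3 • P = 0} ≤ 3)
    (ψ : (ℓ' : ℕ) → (ZMod ℓ')ˣ →* Multiplicative (ZMod (3 ^ 2)))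
    (hψ : Function.Surjective (ψ ℓ)) (hδ : kuriharaNumber D.f (3 ^ 2) ℓ ψ ≠ 0)
    {q : ℚ} (hq : shaAn W = (q : ℂ)) (hv : padicValRat 3 q = 0) : BSDp W 3 := by
  haveI : Fact (Nat.Prime 3) := ⟨Nat.prime_three⟩
  have hsurj : W.HasSurjectiveModNGaloisRep 3 := by simpa using htower 1
  have hirr := hasIrreducibleModPGaloisRep_of_hasSurjectiveModNGaloisRep W 3 hsurj
  have hcert : PlusSymbolLevelLowersAt W 3 D.f ℓ₀ :=
    plusSymbolLevelLowersAt_of_additive_targets hNV hIS D.isNewformOf hN (by norm_num) hirr hℓ₀p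
      hℓ₀M hΔ hc₄ hcℓ₀ hq₀ hq₀1 haq₀ hw hU
  have hℓ₀N : ℓ₀ ∣ W.conductorNorm ℤ := by rw [hN]; exact dvd_mul_left ℓ₀ M
  exact X4RankOne.bsdp_three_of_partial_of_plusSymbolLevelLowersAt_levelTwo W h3 hGZK hmod hX hsurj
    htower hr D hN hc hper hcert hℓ₀N ℓ hℓ hcyc ψ hψ hδ hq hv

end Summit.BirchSwinnertonDyer.Rank1Residual.X4

end
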